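import Mathlib.Analysis.PSeries
import Mathlib.Analysis.SpecificLimits.Basic
import Literature.MathematicalPhysics.QuantumFieldTheory.Balaban1983to89.Beta.RateCertificate

/-!
# Gaps / EndDrawdownSeq — the BOUNDED-DRAWDOWN currency `DwSeq b r` of a real sequence below the line of slope `r`
# («the window sums `Σ_{j∈[k,n)} (b_j − r)` are bounded below»): its [folklore] calculus — monotone in the threshold and in the
# sequence, fed by a pointwise OR an EVENTUAL floor (finitely many terms never matter), insensitive to any finite set of terms,
# decided at EVERY threshold inside a drift class `|Σ_{j<k} b_j − L·k| ≤ A` (`DwSeq b r ⟺ r ≤ L`, boundary included) and hence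
# under a geometric rate, decided only OFF the boundary by mere convergence (harmonic witnesses), and strictly weaker than a
# drift class — a PORT into the tree, with attribution, of the sequence-level half of g1-plan-2's HOME kernel
# `HOME/g1/skeletons/B12Thm2SubDag_plan2.lean` v1.15 (sha16 6167da52388d3b3c; §11 `Dw_*`, §12 `DwSeq*`, §13c, §14a, §14f; lens items
# S-51 ∕ S-52 ∕ S-53 ∕ S-54), restated on bare sequences (cell pub-balaban-gaps, seat g1-p3 GEN 8, rows CAP ∕ tail «split ∕ weakening»;
# file 1 of «the one-loop interface of the END statement»)

HONEST FRAMING (cell rule, page 1 of everything): [folklore] real-sequence arithmetic; NO object of Bałaban's occurs in this file.  Its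
USE is in the companion leaves (`Gaps/EndDrawdownBand`, `Gaps/EndDrawdownSandwich`, …): for a history family `β = β⁰ + β¹` with a
constant-form remainder `−rlo ≤ β¹` on the `]0,γ₀]`-histories, `DwSeq β⁰ rlo` is EXACTLY what the cell's END-grade statement
`DagBinding.EndpointExistence` consumes of the one-loop coefficients `β⁰` (sufficiency through the tree's W-β socket, necessity through
the realised window inequality) — slope-free, rate-free, and blind to every finite set of coefficients (the CAP).  AUTHORSHIP: the
mathematics is g1-plan-2 GEN 22–25's (planner seat; planners file nothing — «g1-p3 ports with attribution»); this seat restates it on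
bare sequences, adds the one-line corollaries marked (this seat), the header and the docstrings, and re-checks it against the tree.
Nothing of Bałaban's is asserted; 0∕6 binders discharged; 0 coefficients certified; NOT [I] Thm 2, NOT `BetaPertH`, NOT the continuum
limit, NOT Clay.

CONTENTS.  §1 the currency and its monotonicity; §2 floors (pointwise, eventual) and finite modifications — `dwSeq_of_eventually_ge`,
`dwSeq_of_eventuallyEq` («the CAP drops out»); §3 constants and convergent sequences (strict thresholds only); §4 drift classes and
geometric rates decide EVERY threshold (`dwSeq_iff_of_oneLoopDrift`, `dwSeq_iff_of_geomRate`); §5 strictness witnesses: the harmonic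
shifts `L ± 1∕(j+1)` (convergence alone does not decide the boundary `r = L`; bounded drawdown + bounded above ⇏ any drift class).

CITATION HEADER (tags CONTEXT ONLY; nothing below is a printed statement).  [I] = T. Bałaban, Commun. Math. Phys. **109** (1987) 249–301
[Balaban1987RG1]: (1.6) p. 259 and (2.12)–(2.14) p. 268 (the one-loop coefficients `β⁰_k` and their limit), Thm 2 p. 259.
-/

namespace Summit.QuantumFields.BalabanUV.Gaps.EndDrawdownSeq

open Literature.MathematicalPhysics.QuantumFieldTheory.Balaban1983to89.Beta.Drift (OneLoopDrift sum_Ico_ge_of_drift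
  abs_sum_Ico_sub_le_of_drift)
open Literature.MathematicalPhysics.QuantumFieldTheory.Balaban1983to89.Beta.RateCertificate (GeomRate)
open Filter Topology Finset

/-! ## §1 The currency -/

/-- **BOUNDED DRAWDOWN below the line of slope `r`**: the window sums `Σ_{j∈[k,n)} (b_j − r)` of the sequence `b` are bounded
below, uniformly in the window — «the running sums of `b` never fall more than `M` below the line of slope `r`».  The one-loop
interface of the END statement read on a bare sequence (g1-plan-2 kernel §11 `Dw_Drawdown` ∕ §12 `DwSeq`, ported). [folklore] -/
def DwSeq (b : ℕ → ℝ) (r : ℝ) : Prop :=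
  ∃ M : ℝ, ∀ k n : ℕ, k ≤ n → -M ≤ ∑ j ∈ Finset.Ico k n, (b j - r)

/-- The drawdown bound can be taken nonnegative (the empty window). [folklore] -/
theorem DwSeq.exists_nonneg {b : ℕ → ℝ} {r : ℝ} (h : DwSeq b r) :
    ∃ M : ℝ, 0 ≤ M ∧ ∀ k n : ℕ, k ≤ n → -M ≤ ∑ j ∈ Finset.Ico k n, (b j - r) := by
  obtain ⟨M, hM⟩ := h
  have h0 := hM 0 0 le_rfl
  rw [Finset.Ico_self, Finset.sum_empty] at h0
  exact ⟨M, by linarith, hM⟩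

/-- Window sums against the line: `Σ_{[k,n)} (b_j − r) = Σ_{[k,n)} b_j − r·(n − k)`. [folklore] -/
theorem sum_Ico_sub_const (b : ℕ → ℝ) (r : ℝ) {k n : ℕ} (hkn : k ≤ n) :
    ∑ j ∈ Finset.Ico k n, (b j - r) = ∑ j ∈ Finset.Ico k n, b j - r * ((n : ℝ) - k) := by
  rw [Finset.sum_sub_distrib, Finset.sum_const, Nat.card_Ico, nsmul_eq_mul, Nat.cast_sub hkn]
  ring

/-- MONOTONE IN THE THRESHOLD: `DwSeq b r ∧ r′ ≤ r ⟹ DwSeq b r′` (kernel §11 `Dw_mono`). [folklore] -/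
theorem dwSeq_mono {b : ℕ → ℝ} {r r' : ℝ} (h : DwSeq b r) (hr : r' ≤ r) : DwSeq b r' := by
  obtain ⟨M, hM⟩ := h
  exact ⟨M, fun k n hkn => (hM k n hkn).trans (Finset.sum_le_sum fun j _ => by linarith)⟩

/-- MONOTONE IN THE SEQUENCE: `b ≤ b′` termwise ⟹ (`DwSeq b r ⟹ DwSeq b′ r`) — more asymptotic freedom never costs drawdown
(kernel §13c `DwSeq_mono_seq`). [folklore] -/
theorem dwSeq_mono_seq {b b' : ℕ → ℝ} {r : ℝ} (hle : ∀ j, b j ≤ b' j) (h : DwSeq b r) : DwSeq b' r := by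
  obtain ⟨M, hM⟩ := h
  exact ⟨M, fun k n hkn => (hM k n hkn).trans (Finset.sum_le_sum fun j _ => by linarith [hle j])⟩

/-! ## §2 Floors and finite modifications: the CAP drops out -/

/-- A POINTWISE floor on or above the line gives bounded drawdown with `M = 0` (kernel §11 `Dw_of_Floor`). [folklore] -/
theorem dwSeq_of_forall_le {b : ℕ → ℝ} {r : ℝ} (h : ∀ j, r ≤ b j) : DwSeq b r :=
  ⟨0, fun k n _ => by
    rw [neg_zero]
    exact Finset.sum_nonneg fun j _ => by linarith [h j]⟩

/-- An EVENTUAL floor on or above the line gives bounded drawdown, with NO hypothesis on the first `k₀` terms (finitely many reals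
are bounded; `M = Σ_{j<k₀} |b_j − r|`) — at END grade only a TAIL statement about the one-loop coefficients is load-bearing, the CAP
drops out (kernel §11 `Dw_of_eventualFloor` ∕ §12a `DwSeq_of_eventually_ge`). [folklore] -/
theorem dwSeq_of_eventually_ge {b : ℕ → ℝ} {r : ℝ} {k₀ : ℕ} (h : ∀ j, k₀ ≤ j → r ≤ b j) : DwSeq b r := by
  refine ⟨∑ j ∈ Finset.range k₀, |b j - r|, fun k n _ => ?_⟩
  have hpt : ∀ j, -(if j < k₀ then |b j - r| else 0) ≤ b j - r := fun j => by
    split_ifs with hj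
    · exact neg_abs_le _
    · have := h j (Nat.le_of_not_lt hj)
      linarith
  have hsum : -(∑ j ∈ Finset.Ico k n, if j < k₀ then |b j - r| else 0) ≤ ∑ j ∈ Finset.Ico k n, (b j - r) := by
    rw [← Finset.sum_neg_distrib]
    exact Finset.sum_le_sum fun j _ => hpt j
  have hle : (∑ j ∈ Finset.Ico k n, if j < k₀ then |b j - r| else 0) ≤ ∑ j ∈ Finset.range k₀, |b j - r| := by
    rw [Finset.sum_ite, Finset.sum_const_zero, add_zero]
    exact Finset.sum_le_sum_of_subset_of_nonneg
      (fun j hj => by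
        simp only [Finset.mem_filter, Finset.mem_Ico, Finset.mem_range] at hj ⊢
        exact hj.2)
      fun _ _ _ => abs_nonneg _
  linarith

/-- INSENSITIVE TO ANY FINITE SET OF TERMS: if `b′ = b` from `k₀` on, `DwSeq b r ⟹ DwSeq b′ r` (the bound grows by
`Σ_{j<k₀} |b′_j − b_j|`) — no finite list of one-loop coefficients, in particular no CAP sign list, is read by the drawdown
(kernel §13c `DwSeq_of_eventuallyEq`). [folklore] -/
theorem dwSeq_of_eventuallyEq {b b' : ℕ → ℝ} {r : ℝ} {k₀ : ℕ} (heq : ∀ j, k₀ ≤ j → b' j = b j) (h : DwSeq b r) :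
    DwSeq b' r := by
  obtain ⟨M, hM⟩ := h
  refine ⟨M + ∑ j ∈ Finset.range k₀, |b' j - b j|, fun k n hkn => ?_⟩
  have h1 : ∑ j ∈ Finset.Ico k n, (b' j - r) = ∑ j ∈ Finset.Ico k n, (b j - r) + ∑ j ∈ Finset.Ico k n, (b' j - b j) := by
    rw [← Finset.sum_add_distrib]
    exact Finset.sum_congr rfl fun j _ => by ring
  have h3 : ∑ j ∈ Finset.Ico k n, (b' j - b j) = ∑ j ∈ (Finset.Ico k n).filter (· < k₀), (b' j - b j) := by
    rw [Finset.sum_filter]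
    exact Finset.sum_congr rfl fun j _ => by
      by_cases hj : j < k₀
      · simp [hj]
      · simp [hj, heq j (not_lt.mp hj)]
  have h4 : ∑ j ∈ (Finset.Ico k n).filter (· < k₀), |b' j - b j| ≤ ∑ j ∈ Finset.range k₀, |b' j - b j| :=
    Finset.sum_le_sum_of_subset_of_nonneg (fun j hj => Finset.mem_range.mpr (Finset.mem_filter.mp hj).2)
      fun _ _ _ => abs_nonneg _
  have h5 : -(∑ j ∈ (Finset.Ico k n).filter (· < k₀), |b' j - b j|) ≤
      ∑ j ∈ (Finset.Ico k n).filter (· < k₀), (b' j - b j) := by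
    rw [← Finset.sum_neg_distrib]
    exact Finset.sum_le_sum fun j _ => neg_abs_le _
  rw [h1, h3]
  linarith [hM k n hkn]

/-- … as an equivalence: two sequences that agree from `k₀` on have bounded drawdown below the same lines (this seat). [folklore] -/
theorem dwSeq_iff_of_eventuallyEq {b b' : ℕ → ℝ} {k₀ : ℕ} (heq : ∀ j, k₀ ≤ j → b' j = b j) (r : ℝ) :
    DwSeq b' r ↔ DwSeq b r :=
  ⟨dwSeq_of_eventuallyEq (fun j hj => (heq j hj).symm), dwSeq_of_eventuallyEq heq⟩

/-- An EVENTUAL margin `δ > 0` BELOW the line kills bounded drawdown: the windows `[k₀, k₀+n)` run away linearly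
(kernel §12a `not_DwSeq_of_eventually_le`). [folklore] -/
theorem not_dwSeq_of_eventually_le {b : ℕ → ℝ} {r δ : ℝ} {k₀ : ℕ} (hδ : 0 < δ) (h : ∀ j, k₀ ≤ j → b j ≤ r - δ) :
    ¬ DwSeq b r := by
  rintro ⟨M, hM⟩
  obtain ⟨n, hn⟩ := exists_nat_gt (M / δ)
  have hw := hM k₀ (k₀ + n) (Nat.le_add_right _ _)
  have hle : ∑ j ∈ Finset.Ico k₀ (k₀ + n), (b j - r) ≤ ∑ j ∈ Finset.Ico k₀ (k₀ + n), (-δ) :=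
    Finset.sum_le_sum fun j hj => by have := h j (Finset.mem_Ico.mp hj).1; linarith
  rw [Finset.sum_const, Nat.card_Ico, add_tsub_cancel_left, smul_neg, nsmul_eq_mul] at hle
  have hM' : M < n * δ := by rwa [div_lt_iff₀ hδ] at hn
  linarith

/-! ## §3 Constants and convergent sequences: strict thresholds only -/

/-- A CONSTANT sequence `c` has bounded drawdown below the `r`-line iff `r ≤ c` (kernel §12a `DwSeq_const_iff`). [folklore] -/
theorem dwSeq_const_iff (c r : ℝ) : DwSeq (fun _ => c) r ↔ r ≤ c := by
  constructor
  · rintro ⟨M, hM⟩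
    refine not_lt.mp fun hlt => ?_
    have hrc : 0 < r - c := by linarith
    obtain ⟨n, hn⟩ := exists_nat_gt (M / (r - c))
    have h := hM 0 n (Nat.zero_le n)
    rw [Finset.sum_const, Nat.card_Ico, Nat.sub_zero, nsmul_eq_mul] at h
    have hM' : M < n * (r - c) := by rwa [div_lt_iff₀ hrc] at hn
    nlinarith
  · intro h
    exact dwSeq_of_forall_le fun _ => h

/-- CONVERGENT sequence, threshold STRICTLY BELOW the limit ⟹ bounded drawdown (kernel §12a `DwSeq_of_tendsto_lt`). [folklore] -/
theorem dwSeq_of_tendsto_lt {b : ℕ → ℝ} {L r : ℝ} (hb : Tendsto b atTop (𝓝 L)) (hr : r < L) : DwSeq b r := by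
  obtain ⟨k₀, hk₀⟩ := Metric.tendsto_atTop.mp hb (L - r) (by linarith)
  exact dwSeq_of_eventually_ge (k₀ := k₀) fun j hj => by
    have h := hk₀ j hj
    rw [Real.dist_eq] at h
    have := (abs_lt.mp h).1
    linarith

/-- CONVERGENT sequence, threshold STRICTLY ABOVE the limit ⟹ NO bounded drawdown (kernel §12a `not_DwSeq_of_tendsto_gt`). [folklore] -/
theorem not_dwSeq_of_tendsto_gt {b : ℕ → ℝ} {L r : ℝ} (hb : Tendsto b atTop (𝓝 L)) (hr : L < r) : ¬ DwSeq b r := by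
  obtain ⟨k₀, hk₀⟩ := Metric.tendsto_atTop.mp hb ((r - L) / 2) (by linarith)
  exact not_dwSeq_of_eventually_le (k₀ := k₀) (δ := (r - L) / 2) (by linarith) fun j hj => by
    have h := hk₀ j hj
    rw [Real.dist_eq] at h
    have := (abs_lt.mp h).2
    linarith

/-- A convergent sequence is bounded above (the one-loop input of the printed upper bound (U)). [folklore] -/
theorem bddAbove_of_tendsto {b : ℕ → ℝ} {L : ℝ} (hb : Tendsto b atTop (𝓝 L)) : ∃ B : ℝ, ∀ j, b j ≤ B := by
  obtain ⟨B, hB⟩ := hb.bddAbove_range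
  exact ⟨B, fun j => hB ⟨j, rfl⟩⟩

/-- A sequence DIVERGING TO `+∞` has bounded drawdown below EVERY line (kernel §13c `EndForced_of_tendsto_atTop`, sequence half). [folklore] -/
theorem dwSeq_of_tendsto_atTop {b : ℕ → ℝ} (hb : Tendsto b atTop atTop) (r : ℝ) : DwSeq b r := by
  obtain ⟨k₀, hk₀⟩ := Filter.tendsto_atTop_atTop.mp hb r
  exact dwSeq_of_eventually_ge hk₀

/-- The sequence `j ↦ j` is not bounded above (so no bounded-above hypothesis can be necessary for drawdown; kernel §13c). [folklore] -/
theorem nat_not_bddAbove : ¬ ∃ B : ℝ, ∀ j : ℕ, (j : ℝ) ≤ B := by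
  rintro ⟨B, hB⟩
  obtain ⟨n, hn⟩ := exists_nat_gt B
  exact lt_irrefl B (hn.trans_le (hB n))

/-! ## §4 Drift classes and geometric rates decide EVERY threshold (boundary included) -/

/-- A DRIFT CLASS at slope `L` (`|Σ_{j<k} b_j − L·k| ≤ A` — row (D1)'s shape) has bounded drawdown below EVERY line `r ≤ L`, the
boundary `r = L` INCLUDED (`M = 2A`; an4's `Beta.Drift.sum_Ico_ge_of_drift`; kernel §11 `Dw_of_D` ∕ §14a `DwSeq_of_oneLoopDrift`). [folklore] -/
theorem dwSeq_of_oneLoopDrift {b : ℕ → ℝ} {L A r : ℝ} (hA : OneLoopDrift L A b) (hr : r ≤ L) : DwSeq b r := by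
  refine ⟨2 * A, fun k n hkn => ?_⟩
  have hdr := sum_Ico_ge_of_drift hA hkn
  have hnk : (0 : ℝ) ≤ (n : ℝ) - k := by
    have : (k : ℝ) ≤ n := by exact_mod_cast hkn
    linarith
  rw [sum_Ico_sub_const b r hkn]
  nlinarith [mul_le_mul_of_nonneg_right hr hnk]

/-- A drift class bounds the sequence above: `b_j ≤ L + 2A` (kernel §11 `B0_of_D`). [folklore] -/
theorem bddAbove_of_oneLoopDrift {b : ℕ → ℝ} {L A : ℝ} (hA : OneLoopDrift L A b) : ∃ B : ℝ, ∀ j, b j ≤ B := by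
  refine ⟨L + 2 * A, fun j => ?_⟩
  have h := (abs_le.mp (abs_sum_Ico_sub_le_of_drift hA (Nat.le_succ j))).2
  rw [Finset.sum_Ico_succ_top (Nat.le_refl j), Finset.Ico_self, Finset.sum_empty, zero_add] at h
  push_cast at h
  linarith

/-- A drift class at slope `L` has UNBOUNDED drawdown below every line STRICTLY ABOVE `L`: the windows `[0,n)` satisfy
`Σ_{j<n} (b_j − r) ≤ A − (r − L)·n`; NO convergence of `b` is used (kernel §14a `not_DwSeq_of_oneLoopDrift_gt`). [folklore] -/
theorem not_dwSeq_of_oneLoopDrift_gt {b : ℕ → ℝ} {L A r : ℝ} (hA : OneLoopDrift L A b) (hr : L < r) : ¬ DwSeq b r := by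
  rintro ⟨M, hM⟩
  have hrL : 0 < r - L := sub_pos.mpr hr
  obtain ⟨n, hn⟩ := exists_nat_gt ((A + M) / (r - L))
  have hn' : A + M < (r - L) * n := by
    have := (div_lt_iff₀ hrL).mp hn
    linarith
  have hw := hM 0 n (Nat.zero_le n)
  rw [← Finset.range_eq_Ico, Finset.sum_sub_distrib, Finset.sum_const, Finset.card_range, nsmul_eq_mul] at hw
  have hd := (abs_le.mp (hA n)).2
  nlinarith [hw, hd, hn']

/-- **IN A DRIFT CLASS AT SLOPE `L` THE DRAWDOWN IS DECIDED AT EVERY THRESHOLD: `DwSeq b r ⟺ r ≤ L`** (boundary included;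
kernel §14a `DwSeq_iff_of_oneLoopDrift`). [folklore] -/
theorem dwSeq_iff_of_oneLoopDrift {b : ℕ → ℝ} {L A : ℝ} (hA : OneLoopDrift L A b) (r : ℝ) : DwSeq b r ↔ r ≤ L :=
  ⟨fun h => not_lt.mp fun hlt => not_dwSeq_of_oneLoopDrift_gt hA hlt h, dwSeq_of_oneLoopDrift hA⟩

/-- A GEOMETRIC (summable) rate to `L` IS a drift class at slope `L` (`GeomRate.drift`), so it too decides the drawdown at every
threshold: `DwSeq b r ⟺ r ≤ L`.  Contrast §3: mere convergence `b_j → L` gives only `r < L ⟹ DwSeq` and `L < r ⟹ ¬ DwSeq`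
(kernel §14a `DwSeq_iff_of_geomRate`). [folklore] -/
theorem dwSeq_iff_of_geomRate {b : ℕ → ℝ} {L c₀ θ : ℝ} (hθ0 : 0 ≤ θ) (hθ1 : θ < 1) (hG : GeomRate b L c₀ θ) (r : ℝ) :
    DwSeq b r ↔ r ≤ L :=
  dwSeq_iff_of_oneLoopDrift (hG.drift hθ0 hθ1) r

/-! ## §5 Strictness witnesses: the harmonic shifts `L ± 1∕(j+1)` -/

/-- `j ↦ L − 1∕(j+1)` converges to `L` (from below). [folklore] -/
theorem tendsto_harmonicBelow (L : ℝ) : Tendsto (fun j : ℕ => L - 1 / ((j : ℝ) + 1)) atTop (𝓝 L) := by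
  simpa using (tendsto_one_div_add_atTop_nhds_zero_nat (𝕜 := ℝ)).const_sub L

/-- `j ↦ L + 1∕(j+1)` converges to `L` (from above). [folklore] -/
theorem tendsto_harmonicAbove (L : ℝ) : Tendsto (fun j : ℕ => L + 1 / ((j : ℝ) + 1)) atTop (𝓝 L) := by
  simpa using (tendsto_one_div_add_atTop_nhds_zero_nat (𝕜 := ℝ)).const_add L

/-- STRICTNESS · `L − 1∕(j+1)` has UNBOUNDED drawdown below the `L`-line: `Σ_{j<n} (b_j − L) = −H_n → −∞` (harmonic divergence).
So CONVERGENCE `b_j → L` ALONE leaves the boundary threshold `r = L` undecided; a drift class ∕ a summable rate closes it (§4)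
(kernel §14f `not_DwSeq_harmonicBelow`). [folklore] -/
theorem not_dwSeq_harmonicBelow (L : ℝ) : ¬ DwSeq (fun j : ℕ => L - 1 / ((j : ℝ) + 1)) L := by
  rintro ⟨M, hM⟩
  obtain ⟨n, hn⟩ := (Real.tendsto_sum_range_one_div_nat_succ_atTop.eventually_gt_atTop M).exists
  have hw := hM 0 n (Nat.zero_le n)
  rw [← Finset.range_eq_Ico] at hw
  have hs : ∑ j ∈ Finset.range n, (L - 1 / ((j : ℝ) + 1) - L) = -∑ j ∈ Finset.range n, (1 / ((j : ℝ) + 1)) := by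
    rw [← Finset.sum_neg_distrib]
    exact Finset.sum_congr rfl fun j _ => by ring
  rw [hs] at hw
  linarith

/-- MIRROR · `L + 1∕(j+1)` HAS bounded drawdown below the `L`-line (`M = 0`: every term lies above the line)
(kernel §14f `DwSeq_harmonicAbove`). [folklore] -/
theorem dwSeq_harmonicAbove (L : ℝ) : DwSeq (fun j : ℕ => L + 1 / ((j : ℝ) + 1)) L :=
  dwSeq_of_forall_le fun j => by
    have : (0 : ℝ) < 1 / ((j : ℝ) + 1) := by positivity
    linarith

/-- **AT THE BOUNDARY, DRAWDOWN IS NOT A FUNCTION OF THE LIMIT**: two sequences with the SAME limit `L`, one with bounded drawdown below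
the `L`-line and one without (kernel §14f `boundary_undecided_by_limit`, sequence half). [folklore] -/
theorem dwSeq_boundary_undecided_by_limit (L : ℝ) :
    ∃ b b' : ℕ → ℝ, Tendsto b atTop (𝓝 L) ∧ Tendsto b' atTop (𝓝 L) ∧ DwSeq b L ∧ ¬ DwSeq b' L :=
  ⟨_, _, tendsto_harmonicAbove L, tendsto_harmonicBelow L, dwSeq_harmonicAbove L, not_dwSeq_harmonicBelow L⟩

/-- STRICTNESS · the harmonically shifted constant sequence `j ↦ r + 1∕(j+1)` lies in NO drift class: for a slope `s ≤ r` its running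
sum runs away above every bound (divergence of the harmonic series); for `s > r` its terms fall below `r + (s − r)∕2`, so the running
sum cannot keep slope `s` (kernel §11 `not_oneLoopDrift_harmonicShift`). [folklore] -/
theorem not_oneLoopDrift_harmonicShift (r s A : ℝ) : ¬ OneLoopDrift s A (fun j => r + 1 / ((j : ℝ) + 1)) := by
  intro hA
  have hU : ∀ k : ℕ, |∑ j ∈ Finset.range k, (1 / ((j : ℝ) + 1)) - (s - r) * k| ≤ A := fun k => by
    have h : |∑ j ∈ Finset.range k, (r + 1 / ((j : ℝ) + 1)) - s * k| ≤ A := hA k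
    have hs : ∑ j ∈ Finset.range k, (r + 1 / ((j : ℝ) + 1)) - s * k
        = ∑ j ∈ Finset.range k, (1 / ((j : ℝ) + 1)) - (s - r) * k := by
      rw [Finset.sum_add_distrib, Finset.sum_const, Finset.card_range, nsmul_eq_mul]
      ring
    rw [hs] at h
    exact h
  rcases le_or_gt (s - r) 0 with hc0 | hc0
  · obtain ⟨k, hk⟩ := (Real.tendsto_sum_range_one_div_nat_succ_atTop.eventually_gt_atTop A).exists
    have h1 := (abs_le.mp (hU k)).2
    have hk0 : (0 : ℝ) ≤ k := Nat.cast_nonneg k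
    nlinarith [h1, hk, hc0, hk0, mul_nonneg (neg_nonneg.mpr hc0) hk0]
  · obtain ⟨J, hJ⟩ := exists_nat_gt (2 / (s - r))
    have hsmall : ∀ j : ℕ, J ≤ j → 1 / ((j : ℝ) + 1) ≤ (s - r) / 2 := fun j hj => by
      have hJj : (J : ℝ) ≤ j := Nat.cast_le.mpr hj
      have hJ2 : 2 < (s - r) * J := by
        have := (div_lt_iff₀ hc0).mp hJ
        linarith
      rw [div_le_iff₀ (by positivity)]
      nlinarith [mul_le_mul_of_nonneg_left hJj hc0.le]
    obtain ⟨m, hm⟩ := exists_nat_gt (4 * A / (s - r))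
    have hm' : 4 * A < (s - r) * m := by
      have := (div_lt_iff₀ hc0).mp hm
      linarith
    have hJk : J ≤ J + m := Nat.le_add_right J m
    have hlo := (abs_le.mp (hU (J + m))).1
    have hhi := (abs_le.mp (hU J)).2
    have hsplit : ∑ j ∈ Finset.range (J + m), (1 / ((j : ℝ) + 1))
        = ∑ j ∈ Finset.range J, (1 / ((j : ℝ) + 1)) + ∑ j ∈ Finset.Ico J (J + m), (1 / ((j : ℝ) + 1)) :=
      (Finset.sum_range_add_sum_Ico _ hJk).symm
    have hwin : ∑ j ∈ Finset.Ico J (J + m), (1 / ((j : ℝ) + 1)) ≤ (m : ℝ) * ((s - r) / 2) := by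
      calc ∑ j ∈ Finset.Ico J (J + m), (1 / ((j : ℝ) + 1)) ≤ ∑ j ∈ Finset.Ico J (J + m), (s - r) / 2 :=
            Finset.sum_le_sum fun j hj => hsmall j (Finset.mem_Ico.mp hj).1
        _ = (m : ℝ) * ((s - r) / 2) := by
            rw [Finset.sum_const, Nat.card_Ico, nsmul_eq_mul, Nat.add_sub_cancel_left]
    push_cast at hlo
    linarith

/-- **BOUNDED DRAWDOWN + BOUNDED ABOVE ⇏ ANY DRIFT CLASS**: for every threshold `r` the sequence `j ↦ r + 1∕(j+1)` has bounded drawdown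
below the `r`-line (`M = 0`) and is bounded above (`≤ r + 1`), yet lies in no drift class — the END statement's one-loop interface
(`DwSeq`) is STRICTLY WEAKER than row (D1)'s drift shape (kernel §11 `Dw_B0_not_D`, sequence half). [folklore] -/
theorem dwSeq_bddAbove_not_drift (r : ℝ) :
    ∃ b : ℕ → ℝ, DwSeq b r ∧ (∃ B : ℝ, ∀ j, b j ≤ B) ∧ ∀ s A : ℝ, ¬ OneLoopDrift s A b := by
  refine ⟨fun j => r + 1 / ((j : ℝ) + 1), dwSeq_harmonicAbove r, ⟨r + 1, fun j => ?_⟩,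
    fun s A => not_oneLoopDrift_harmonicShift r s A⟩
  show r + 1 / ((j : ℝ) + 1) ≤ r + 1
  have : 1 / ((j : ℝ) + 1) ≤ 1 := by
    rw [div_le_one (by positivity)]
    linarith [(Nat.cast_nonneg j : (0 : ℝ) ≤ j)]
  linarith

end Summit.QuantumFields.BalabanUV.Gaps.EndDrawdownSeq
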